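/-
Copyright (c) 2026 the pub-hodgecm-mathlib formalisation cell (harness21).  Prover seat hodgecm-mathlib-K2E3-p26 (g0), Track B «K2-LIT» ∕ h413
(`stmt-HodgeConjecture-24833`), line `K2_E3_EllipticInputs`, PART «RANK» leaf (qs2-res) `sig_K2E3CharLocIntNearIdentityResidualQuasiSplitTwo`, deal D127: THE PAYER-SHAPED
ASSEMBLY OF (qs2-res) OVER THE CUT (A)∕(B)∕(C), hypothesis-first in the (ASM₂-rep) letter and the (res-ω) leaf.  2026-09-04.
-/
import Summits.HodgeConjecture.HodgeConjecture.Theorems.K2E3U2PrincipalSeriesNoThreeChain        -- ★ D121 (this seat): `not_bot_lt_lt_lt_top_cmPrincipalSeries_two` (= `hlen`)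
import Summits.HodgeConjecture.HodgeConjecture.Theorems.K2E3U2PrincipalSeriesReducibleCut         -- ★ D122 (architect K2E3-p25 (g3)): `reducible_cut_cmPrincipalSeries_two` (A)∕(B)∕(C)
import Summits.HodgeConjecture.HodgeConjecture.Theorems.K2E3CharLocIntDifferenceOfRepresentedTwo  -- ★ D123 (K2E3-p23 (g7)): branch (B) `charLocIntNear_of_smoothTrace_eq_cmPrincipalSeries_two_sub_finite`
import Summits.HodgeConjecture.HodgeConjecture.Theorems.K2E3CharLocIntNearSemisimpleFinDim        -- ★ p855012 (K2E3-p11 (g0)): branch (A) `charLocIntNear_of_finite`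
import HarnessLib

/-!
# K2_E3 road (h413), PART «RANK», leaf (qs2-res) — the payer-shaped assembly over the cut of a reducible principal series of `U(Φ₂)(L⁺_v)`

Cell `pub/hodgecm-mathlib` (D-0151), Track B, seat K2E3-p26 (g0), dealer K2E3-plan (g4) deal D127 (2026-09-04T14:10:30Z), architect K2E3-p25 (g3) ruling (R1)∕(R2) 13:58:41Z.
`--supports stmt-HodgeConjecture-24833 --as helper`; THEOREMS ONLY (no definition ∕ instance ∕ notation ∕ named fact ∕ `sorry`); never imports `Cruxes/…/Lines`.  COUNT-NEUTRAL
until the dealer's tie: the LAST theorem concludes the bytes of the hosted leaf (qs2-res) `sig_K2E3CharLocIntNearIdentityResidualQuasiSplitTwo` (PART «RANK» :101) token for token,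
from TWO named antecedents — `hrep` = the (ASM₂-rep) letter «van Dijk₂ at the representation level: the character of `cmPrincipalSeries L 2 v χ` (`χ` continuous, irreducible
or not) is an integrable function near every point» (K2E3-p21 (g8), architect (R2)) and `hω` = the (res-ω) leaf (this seat's sub-socket text `K2/K2E3-p26/g0/subsocket_res-omega.text.txt`,
the ω-type corner (C), XL-adjacent, OPEN).

THE MATHEMATICS ([Casselman1995, §7.1, Cor. 7.1.2]; [Rogawski1990, §12.1 pp. 171–172]; [HarishChandra1999, Thm. 16.1]).  Let `v` be non-split, `χ` a continuous character of `T₂`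
with `ρ = i_G(χ)` REDUCIBLE and `c` a constituent.  `ρ` has no chain `⊥ < N₁ < N₂ < ⊤` (★ D121, Jacquet rank `≤ 2` strictly monotone), so the cut ★ D122 applies: (A) `c` is the
class of a FINITE-DIMENSIONAL `r` — its character is the locally constant function `tr r(g)` (★ p855012 `charLocIntNear_of_finite`); (B) `Tr c = Tr i_G(χ) − Tr π₁` for a
finite-dimensional smooth `π₁` — `Tr i_G(χ)` is an integrable function near `1` by `hrep` and `Tr π₁` is locally constant, so their difference is represented near `1` (★ D123
`charLocIntNear_of_smoothTrace_eq_cmPrincipalSeries_two_sub_finite`); (C) no finite-dimensional constituent — the (res-ω) leaf `hω`.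

* **`charLocIntNearIdentityResidual_of_cut (hrep) (hω) : <the (qs2-res) socket bytes>`**.

HONEST LABEL: HC_CM is proved only modulo the 7 printed citations (2 remaining named inputs: hLiu418 = stmt-HodgeConjecture-24832, h413 =
stmt-HodgeConjecture-24833) until rung 0 closes; count-neutral: the tie makes (qs2-res) REL over EXACTLY {(ASM₂-rep), (res-ω)}.

## References
* [Casselman1995] W. Casselman, *Introduction to the theory of admissible representations of 𝔭-adic reductive groups* (1995), §7.1, Cor. 7.1.2 p. 67.
* [Rogawski1990] J. D. Rogawski, *Automorphic Representations of Unitary Groups in Three Variables*, Ann. of Math. Stud. 123 (1990), §12.1 pp. 171–172.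
* [HarishChandra1999] Harish-Chandra (DeBacker–Sally), *Admissible Invariant Distributions on Reductive p-adic Groups* (1999), Thm. 16.1 p. 77.
* [vanDijk1972] G. van Dijk, *Computation of certain induced characters of 𝔭-adic groups*, Math. Ann. 199 (1972), Thm. p. 237.
-/

set_option autoImplicit false
set_option linter.dupNamespace false

noncomputable section

open MeasureTheory NumberField IsDedekindDomain Topology
open scoped MatrixGroups
open Literature.NumberTheory.Automorphic Literature.NumberTheory.Automorphic.UnitaryGroup

namespace Summit.HodgeConjecture.HodgeConjecture.Cruxes.H413.K2E3CharLocIntNearIdentityResidualQuasiSplitTwoOfCut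

set_option maxHeartbeats 1600000 in
set_option synthInstance.maxHeartbeats 400000 in
-- statement-heavy: three `∀`-closed letters on the induced model `cmPrincipalSeries L 2 v χ` (as ★ D122 §3)
/-- **LEAF (qs2-res) FROM THE (ASM₂-rep) LETTER AND THE (res-ω) LEAF** — the bytes of the hosted socket `sig_K2E3CharLocIntNearIdentityResidualQuasiSplitTwo` (PART «RANK»
:101), token for token, from: `hrep` «the character of `cmPrincipalSeries L 2 v χ` (`χ` continuous) is an integrable function near every `s`» (architect (R2), K2E3-p21 (g8)) and
`hω` «the (qs2-res) conclusion in the ω-type corner (C)» (this seat's sub-socket (res-ω)).  Dispatch over ★ D122 `reducible_cut_cmPrincipalSeries_two` (its `hlen` = ★ D121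
`not_bot_lt_lt_lt_top_cmPrincipalSeries_two`): (A) ★ p855012 `charLocIntNear_of_finite`; (B) ★ D123 `charLocIntNear_of_smoothTrace_eq_cmPrincipalSeries_two_sub_finite` fed by
`hrep`; (C) `hω`. [cite: Casselman1995, §7.1, Cor. 7.1.2 p. 67] [cite: Rogawski1990, §12.1 pp. 171–172] [cite: HarishChandra1999, Thm. 16.1 p. 77] -/
theorem charLocIntNearIdentityResidual_of_cut
    (hrep : ∀ (L : Type) [Field L] [NumberField L] [IsCMField L] (v : HeightOneSpectrum (𝓞 ↥(maximalRealSubfield L))),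
      (∀ w : PlacesOver L v, IsCMField.complexConj L • w.1 = w.1) →
      ∀ [MeasurableSpace ↥(unitaryGroupOfForm (conjLocal L (IsCMField.complexConj L) v) (cmLocalForm L 2 v))] [BorelSpace ↥(unitaryGroupOfForm (conjLocal L (IsCMField.complexConj L) v) (cmLocalForm L 2 v))]
        (μ : Measure ↥(unitaryGroupOfForm (conjLocal L (IsCMField.complexConj L) v) (cmLocalForm L 2 v))) [μ.IsHaarMeasure]
        (χ : ↥(cmBorelTriple L 2 v).M →* ℂˣ), Continuous (fun t => ((χ t : ℂˣ) : ℂ)) →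
      ∀ s : ↥(unitaryGroupOfForm (conjLocal L (IsCMField.complexConj L) v) (cmLocalForm L 2 v)),
        ∃ U : Set ↥(unitaryGroupOfForm (conjLocal L (IsCMField.complexConj L) v) (cmLocalForm L 2 v)), IsOpen U ∧ s ∈ U ∧
          ∃ Θ : ↥(unitaryGroupOfForm (conjLocal L (IsCMField.complexConj L) v) (cmLocalForm L 2 v)) → ℂ, IntegrableOn Θ U μ ∧
            ∀ f : ↥(unitaryGroupOfForm (conjLocal L (IsCMField.complexConj L) v) (cmLocalForm L 2 v)) → ℂ, f ∈ SchwartzBruhat ↥(unitaryGroupOfForm (conjLocal L (IsCMField.complexConj L) v) (cmLocalForm L 2 v)) →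
              tsupport f ⊆ U → Representation.smoothTrace (G := ↥(unitaryGroupOfForm (conjLocal L (IsCMField.complexConj L) v) (cmLocalForm L 2 v))) (UnitaryGroup.cmPrincipalSeries L 2 v χ) μ f = ∫ g, f g * Θ g ∂μ)
    (hω : ∀ (L : Type) [Field L] [NumberField L] [IsCMField L] (v : HeightOneSpectrum (𝓞 ↥(maximalRealSubfield L))),
      (∀ w : PlacesOver L v, IsCMField.complexConj L • w.1 = w.1) →
      ∀ [MeasurableSpace ↥(unitaryGroupOfForm (conjLocal L (IsCMField.complexConj L) v) (cmLocalForm L 2 v))] [BorelSpace ↥(unitaryGroupOfForm (conjLocal L (IsCMField.complexConj L) v) (cmLocalForm L 2 v))]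
        (μ : Measure ↥(unitaryGroupOfForm (conjLocal L (IsCMField.complexConj L) v) (cmLocalForm L 2 v))) [μ.IsHaarMeasure] (c : IrrClass ↥(unitaryGroupOfForm (conjLocal L (IsCMField.complexConj L) v) (cmLocalForm L 2 v)))
        (χ : ↥(cmBorelTriple L 2 v).M →* ℂˣ), Continuous (fun t => ((χ t : ℂˣ) : ℂ)) →
        c.IsConstituentOf (UnitaryGroup.cmPrincipalSeries L 2 v χ) → ¬ (UnitaryGroup.cmPrincipalSeries L 2 v χ).IsIrreducible →
        (∀ r : SmoothIrrep ↥(unitaryGroupOfForm (conjLocal L (IsCMField.complexConj L) v) (cmLocalForm L 2 v)), (IrrClass.mk r).IsConstituentOf (UnitaryGroup.cmPrincipalSeries L 2 v χ) → ¬ FiniteDimensional ℂ r.V) →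
        ∃ U : Set ↥(unitaryGroupOfForm (conjLocal L (IsCMField.complexConj L) v) (cmLocalForm L 2 v)), IsOpen U ∧ (1 : ↥(unitaryGroupOfForm (conjLocal L (IsCMField.complexConj L) v) (cmLocalForm L 2 v))) ∈ U ∧
          ∃ Θ : ↥(unitaryGroupOfForm (conjLocal L (IsCMField.complexConj L) v) (cmLocalForm L 2 v)) → ℂ, IntegrableOn Θ U μ ∧
            ∀ f : ↥(unitaryGroupOfForm (conjLocal L (IsCMField.complexConj L) v) (cmLocalForm L 2 v)) → ℂ, f ∈ SchwartzBruhat ↥(unitaryGroupOfForm (conjLocal L (IsCMField.complexConj L) v) (cmLocalForm L 2 v)) →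
              tsupport f ⊆ U → c.smoothTrace μ f = ∫ g, f g * Θ g ∂μ) :
  ∀ (L : Type) [Field L] [NumberField L] [IsCMField L] (v : HeightOneSpectrum (𝓞 ↥(maximalRealSubfield L))),
      (∀ w : PlacesOver L v, IsCMField.complexConj L • w.1 = w.1) →
      ∀ [MeasurableSpace ↥(unitaryGroupOfForm (conjLocal L (IsCMField.complexConj L) v) (cmLocalForm L 2 v))] [BorelSpace ↥(unitaryGroupOfForm (conjLocal L (IsCMField.complexConj L) v) (cmLocalForm L 2 v))]
        (μ : Measure ↥(unitaryGroupOfForm (conjLocal L (IsCMField.complexConj L) v) (cmLocalForm L 2 v))) [μ.IsHaarMeasure] (c : IrrClass ↥(unitaryGroupOfForm (conjLocal L (IsCMField.complexConj L) v) (cmLocalForm L 2 v)))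
        (χ : ↥(cmBorelTriple L 2 v).M →* ℂˣ), Continuous (fun t => ((χ t : ℂˣ) : ℂ)) →
        c.IsConstituentOf (UnitaryGroup.cmPrincipalSeries L 2 v χ) → ¬ (UnitaryGroup.cmPrincipalSeries L 2 v χ).IsIrreducible →
        ∃ U : Set ↥(unitaryGroupOfForm (conjLocal L (IsCMField.complexConj L) v) (cmLocalForm L 2 v)), IsOpen U ∧ (1 : ↥(unitaryGroupOfForm (conjLocal L (IsCMField.complexConj L) v) (cmLocalForm L 2 v))) ∈ U ∧
          ∃ Θ : ↥(unitaryGroupOfForm (conjLocal L (IsCMField.complexConj L) v) (cmLocalForm L 2 v)) → ℂ, IntegrableOn Θ U μ ∧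
            ∀ f : ↥(unitaryGroupOfForm (conjLocal L (IsCMField.complexConj L) v) (cmLocalForm L 2 v)) → ℂ, f ∈ SchwartzBruhat ↥(unitaryGroupOfForm (conjLocal L (IsCMField.complexConj L) v) (cmLocalForm L 2 v)) →
              tsupport f ⊆ U → c.smoothTrace μ f = ∫ g, f g * Θ g ∂μ := by
  intro L _ _ _ v hns instMeas instBorel μ instHaar c χ hχ hconst hred
  haveI := locallyCompactSpace_cmBorelU L 2 v
  -- the cut (★ D122) with `hlen` = ★ D121
  have hlen := K2E3U2PrincipalSeriesNoThreeChain.not_bot_lt_lt_lt_top_cmPrincipalSeries_two L v hns χ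
  have hcut := K2E3U2PrincipalSeriesReducibleCut.reducible_cut_cmPrincipalSeries_two L v μ χ hlen hred c hconst
  rcases hcut with ⟨r, hrc, hfd⟩ | ⟨V₁, _, _, _, π₁, hπ₁, hsub⟩ | hC
  · -- (A) a finite-dimensional class
    subst hrc
    -- carrier `(cmDatum L 2 Φ₂).Local v = G₂` (★ `cmDatum_Local_eq`, `rfl`): the instances are passed through the definitional equality
    exact @K2E3CharLocIntNearSemisimpleFinDim.charLocIntNear_of_finite L _ _ _ 2 (Matrix.of fun i j : Fin 2 => if i.val + j.val + 1 = 2 then (1 : L) else 0) v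
      instMeas instBorel μ instHaar r hfd 1
  · -- (B) trace difference with a finite-dimensional smooth `π₁`
    exact K2E3CharLocIntDifferenceOfRepresentedTwo.charLocIntNear_of_smoothTrace_eq_cmPrincipalSeries_two_sub_finite L v μ χ (hrep L v hns μ χ hχ)
      π₁ hπ₁ c (fun f _ => hsub f) 1
  · -- (C) the ω-type corner
    exact hω L v hns μ c χ hχ hconst hred hC

end Summit.HodgeConjecture.HodgeConjecture.Cruxes.H413.K2E3CharLocIntNearIdentityResidualQuasiSplitTwoOfCut

end
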